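import Literature.AnabelianGeometry.EtaleTheta.SettingBridgeCuspLaws
import Literature.AnabelianGeometry.EtaleTheta.SettingModelKrullCusp
import HarnessLib

/-!
# The cusp laws HOLD at the untwisted Krull model `modelκ′` — the JOINT WITNESS of the 13:00Z census items
# C16 / C9 / C3: `CuspLaws ∧ Nonempty OncePuncturedData ∧ IsEtThOrigin` at ONE `ThetaSetting` (proof-only)

S. Mochizuki, *The étale theta function …*, Publ. RIMS **45** (2009) [EtTh], Def. 2.1 preamble p. 35 («the unique
cusp of `X^log`», «`D_x → Π^Θ_X` … maps the inertia group `I_x ⊆ D_x` isomorphically onto `Δ_Θ`»), Prop. 2.2 (ii)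
p. 37 (splittings of `D_x ↠ G_K`; the cusp is `K`-rational) [cite: MochizukiEtTh2009, Def 2.1 p.35].

Cell abc-iut, layer L2 (NV lane), seat abc-iut-L2-t7 (gen 4) — owner of `OncePuncturedData`, filer of the census
predicate `ThetaSetting.CuspLaws` (`SettingBridgeCuspLaws`, p440731).  PROOF-ONLY (0 definitions), over
abc-iut-L2-t10's untwisted KRULL model WITH the COMMUTATOR-AXIS cusp (`SettingModelKrullCusp`, K3b:
`ThetaSetting.modelκ′ p`, `Π^tp_X := Γ ⋊_{θ∘1} G_{ℚ_p}` with the Krull topology on the Galois factor, ONE cusp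
`D_x = c^Ẑ ⋊ G_{ℚ_p}`; `nonempty_oncePuncturedData_modelκ'`, `map_toHat_inertia_modelκ'`,
`closure_pair_inl_eta_eq_top`, `continuous_inrκ`) and abc-iut-w5-d165's root-clause engine
`ThetaSetting.map_toTheta_inertia_eq_deltaTheta_of_commutatorAxis` (`Sec2InertiaOntoDeltaTheta`), all BY NAME:

* `cusp_unique_modelκ'` — C16 (`Pt := Unit`);
* `exists_continuous_section_modelκ'` — C9: `σ ↦ (1, σ)` is a CONTINUOUS section of `D_x ↠ G_K` (Krull factor!);
* `map_toTheta_inertia_modelκ'_eq_deltaTheta` — C3 in the `l`-free root form `toTheta(I_x) = Δ_Θ` (the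
  commutator-axis clause `toHat(I_x) = ⟨[a,b]⟩⁻` of K3b through the engine);
* **`cuspLaws_modelκ'`** — `(ThetaSetting.modelκ′ p).CuspLaws`, and the census summary
  **`ThetaSetting.exists_isEtThOrigin_cuspLaws_oncePuncturedData`** — root interface + guard `IsEtThOrigin` +
  the parameter bundle `OncePuncturedData` + ALL THREE cusp laws are JOINTLY SATISFIABLE (the truth table of
  `SettingModelCuspLawsCensus` / `SettingModel2CommutatorCuspLaws` had no such row: (✓,✓,✗) at the χ-models,
  (✓,✗,✓) at `model₂ᶜ`);
* consequences read through the adapters: the per-`l` inertia clauses for ALL `l > 0` at `modelκ′`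
  (`forall_inertiaClause_modelκ'`) and the bridge's cusp family is one conjugacy class.

HONEST LABEL: `modelκ′` is a SEMI-SYNTHETIC model (trivial Galois action on `Γ`: the `Compat`/Kummer clauses of §1
are NOT served by it) — consistency evidence only, not the tempered `π₁` of a once-punctured elliptic curve; nothing
of [EtTh] asserted; no side taken on [IUTchIII] Cor. 3.12; typed ≠ proved.
-/

noncomputable section

namespace Literature.AnabelianGeometry.EtaleTheta.SettingModel

open Literature.AnabelianGeometry.SemiGraphs _root_.Topology
open scoped commutatorElement

variable (p : ℕ) [Fact p.Prime]

/-- C16 at `modelκ′`: the cusp is unique (`Pt := Unit`). [cite: MochizukiEtTh2009, Def 2.1 p.35] -/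
theorem cusp_unique_modelκ' :
    ∀ x x' : (ThetaSetting.modelκ' p).Pt, (ThetaSetting.modelκ' p).IsCusp x →
      (ThetaSetting.modelκ' p).IsCusp x' → x' = x :=
  fun _ _ _ _ => rfl

/-- C9 at `modelκ′`: `σ ↦ (1, σ)` is a continuous section of `D_x = c^Ẑ ⋊ G_{ℚ_p} ↠ G_K` — continuous because
the Galois factor carries its Krull topology (contrast `model₂ᶜ`, `SettingModel2CommutatorCuspLaws`).
[cite: MochizukiEtTh2009, Prop 2.2(ii) p.37] -/
theorem exists_continuous_section_modelκ' :
    ∀ x : (ThetaSetting.modelκ' p).Pt, (ThetaSetting.modelκ' p).IsCusp x →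
      ∃ s : ↥(ThetaSetting.modelκ' p).GK →* (ThetaSetting.modelκ' p).PiTemp, Continuous s ∧
        (∀ σ, s σ ∈ (ThetaSetting.modelκ' p).decomp x) ∧
        ∀ σ, (ThetaSetting.modelκ' p).aug (s σ) = (σ : GQp p) := by
  intro x _
  refine ⟨(SemidirectProduct.inr : GQp p →* PiTpκ p).comp (ThetaSetting.modelκ' p).GK.subtype,
    (continuous_inrκ p).comp continuous_subtype_val, fun σ => ?_, fun σ => rfl⟩
  change (SemidirectProduct.inr (σ : GQp p) : PiTpκ p) ∈ cuspDecompκ p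
  rw [mem_cuspDecompκ_iff, SemidirectProduct.left_inr]
  exact Subgroup.one_mem _

/-- C3 at `modelκ′`, `l`-free root form: `toTheta(I_x) = Δ_Θ` — abc-iut-L2-t10's commutator-axis clause
`map_toHat_inertia_modelκ'` through abc-iut-w5-d165's engine. [cite: MochizukiEtTh2009, Def 2.1 p.35] -/
theorem map_toTheta_inertia_modelκ'_eq_deltaTheta (x : (ThetaSetting.modelκ' p).Pt) :
    ((ThetaSetting.modelκ' p).inertia x).map (ThetaSetting.modelκ' p).toTheta = (ThetaSetting.modelκ' p).DeltaTheta :=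
  (ThetaSetting.modelκ' p).map_toTheta_inertia_eq_deltaTheta_of_commutatorAxis x (closure_pair_inl_eta_eq_top p)
    (map_toHat_inertia_modelκ' p x)

/-- **The cusp laws hold at `modelκ′`.** [cite: MochizukiEtTh2009, Def 2.1 p.35] -/
theorem cuspLaws_modelκ' : (ThetaSetting.modelκ' p).CuspLaws where
  cusp_unique := cusp_unique_modelκ' p
  exists_continuous_section := exists_continuous_section_modelκ' p
  map_toTheta_inertia := fun x _ => map_toTheta_inertia_modelκ'_eq_deltaTheta p x

/-- **JOINT WITNESS (census C16 / C9 / C3)**: there is a `ThetaSetting` satisfying the guard `IsEtThOrigin`, carrying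
the once-punctured parameter bundle `OncePuncturedData`, at which ALL THREE cusp laws hold.
[cite: MochizukiEtTh2009, Def 2.1 p.35] -/
theorem _root_.Literature.AnabelianGeometry.EtaleTheta.ThetaSetting.exists_isEtThOrigin_cuspLaws_oncePuncturedData :
    ∃ D : ThetaSetting p, D.IsEtThOrigin ∧ D.CuspLaws ∧ Nonempty D.OncePuncturedData :=
  ⟨ThetaSetting.modelκ' p, ThetaSetting.modelκ'_isEtThOrigin p, cuspLaws_modelκ' p,
    nonempty_oncePuncturedData_modelκ' p⟩

/-! ### Read through the adapters -/

/-- At `modelκ′` the per-`l` §1-side inertia clauses hold for EVERY `l > 0` (census C3 in abc-iut-L2-t10's reduced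
per-`l` form; through `CuspLaws.forall_inertiaClause`, compactness of `D_x` from the bundle).
[cite: MochizukiEtTh2009, Def 2.1 p.35] -/
theorem forall_inertiaClause_modelκ' (x : (ThetaSetting.modelκ' p).Pt) :
    ∀ l, 0 < l → ((ThetaSetting.modelκ' p).inertia x).map (ThetaSetting.modelκ' p).toHat.toMonoidHom ⊔
      (ThetaSetting.modelκ' p).barKerHat l = (ThetaSetting.modelκ' p).barThetaHat l :=
  (cuspLaws_modelκ' p).forall_inertiaClause (nonempty_oncePuncturedData_modelκ' p).some trivial

/-- At `modelκ′` the cusp family of the once-punctured bridge is ONE `Π^tp_X`-conjugacy class (through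
`CuspLaws.mem_cuspDecompFamily_iff`). [cite: MochizukiEtTh2009, §1 p.13] -/
theorem mem_cuspDecompFamily_modelκ'_iff (H : Subgroup (ThetaSetting.modelκ' p).PiTemp) :
    H ∈ (ThetaSetting.modelκ' p).cuspDecompFamily ↔
      ∃ g : (ThetaSetting.modelκ' p).PiTemp, H = (cuspDecompκ p).map (MulAut.conj g).toMonoidHom :=
  (cuspLaws_modelκ' p).mem_cuspDecompFamily_iff (x := ()) trivial H

/-- The full census row at `modelκ′`: C16 ∧ C9 ∧ C3 ∧ CuspLaws ∧ bundle inhabited ∧ guard.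
[cite: MochizukiEtTh2009, Def 2.1 p.35] -/
theorem cuspLaws_census_modelκ' :
    (ThetaSetting.modelκ' p).CuspLaws ∧ Nonempty (ThetaSetting.modelκ' p).OncePuncturedData ∧
      (ThetaSetting.modelκ' p).IsEtThOrigin :=
  ⟨cuspLaws_modelκ' p, nonempty_oncePuncturedData_modelκ' p, ThetaSetting.modelκ'_isEtThOrigin p⟩

end Literature.AnabelianGeometry.EtaleTheta.SettingModel

end
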